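import Summits.ValiantsHypothesis.ValiantsHypothesis.Theorems.KPlusLogSqLawTropicalBTwoRowSharp
import Summits.ValiantsHypothesis.ValiantsHypothesis.Theorems.KPlusLogSqLawSymmetricDesigns

/-!
# Route «KPlusLogSqLaw», crux `TropicalB` (stmt-ValiantsHypothesis-19771) — the SYMMETRIC `m = 2` tropical row, sharp ceiling:
# a symmetric `2 × 2` dominance design has at most `3K − 4` sign-alternating dominant breakpoints

HONEST FRAMING.  Helper file (seat val-sym-trop-p4 (g2), cell `pub-symmetroid`, 2026-08-26).  A SMALL-FORMAT row (`m = 2`, every `K ≥ 2`),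
far inside the crux's known regime; nothing on `TropicalB` in its window, `WeakLifting`, `MatrixDescartes` (stmt-ValiantsHypothesis-18050) or
VP ≠ VNP.  It turns the cell's paper ceiling «`T_sym(2,K) ≤ 3K − 4`» (HOME/DATA-CUT-0823.md l.556 (b)/(e): «the symmetric monomial `b_i b_j`
(`i ≠ j`) is never a hull vertex», referee check welcome) into a kernel theorem; the matching lower bound is the tree's symmetric chain
`SymmetricTwoK.le_of_tropRootLawAt_two` (`3K − 4` attained, `K ≥ 3`), so the symmetric `m = 2` tropical row is EXACTLY `3K − 4`, against
`4K − 7` for general `2 × 2` designs (`tropRootLawAt_two_sharp` / `…TwoRowFamily`).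

* `tropRow_two_symm_le : 2 ≤ K → (symmetric v, ε) → … → n ≤ 3 * K - 4` (stated over an explicit chain; the tree has no symmetric-row predicate).

PROOF.  Identity terms: `k ↦ termRank` is injective among them (column monotonicity, as in the thin law) — at most `2K − 1`.  Transposition
terms: a dominant term of a SYMMETRIC design is fixed by transposition (`TropicalCensus.isDominant_symm_involutive`), so its two classes
coincide, its slope is `2 d_a`, and `k ↦ dRank a` is injective among them — at most `K`.  The identity term of total rank `0` and the
transposition term of rank `0` both have slope `2·d_min` (ranks determine exponent values, `d_eq_of_dRank_eq`), so at most one of them occurs;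
likewise at the top.  Hence `n + 1 ≤ (2K − 1) + K − 2 = 3K − 3`.  [cell statement; folklore proof]
-/

set_option linter.dupNamespace false
set_option autoImplicit false

namespace Summit.ValiantsHypothesis.ValiantsHypothesis.Theorems.KPlusLogSqLaw

open Summit.ValiantsHypothesis.ValiantsHypothesis.Theorems.MatrixDescartes.Negative
open Summit.ValiantsHypothesis.ValiantsHypothesis.Theorems.LacunarySymmetroidMatrixDescartes
open Summit.ValiantsHypothesis.ValiantsHypothesis.Theorems.LacunarySymmetroidMatrixDescartes.TropicalCensus
open Finset

/-- **Sharp symmetric `m = 2` tropical row**: a SYMMETRIC `2 × 2` dominance design with `K ≥ 2` classes has at most `3K − 4`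
sign-alternating dominant breakpoints. [cell statement; folklore proof] -/
theorem tropRow_two_symm_le (K : ℕ) (hK : 2 ≤ K) (d : Fin K → ℕ) (v ε : Fin 2 → Fin 2 → Fin K → ℤ)
    (hv : ∀ i j l, v i j l = v j i l) (hεs : ∀ i j l, ε i j l = ε j i l)
    (n : ℕ) (θ : Fin (n + 1) → ℤ) (p : Fin (n + 1) → Equiv.Perm (Fin 2) × (Fin 2 → Fin K))
    (hθ : StrictMono θ) (hdom : ∀ k, IsDominant d v ε (θ k) (p k))
    (halt : ∀ k : Fin n, termSign ε (p k.castSucc) * termSign ε (p k.succ) < 0) : n ≤ 3 * K - 4 := by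
  have hinj : Function.Injective p := stub_dominantInjective 2 K d v ε n θ p hθ hdom halt
  have perm_fin_two : ∀ σ : Equiv.Perm (Fin 2), σ = 1 ∨ σ = Equiv.swap 0 1 := by decide
  -- (1) identity terms: total rank strictly increases (as in `tropRootLawAt_thin`)
  have hkey : ∀ a b : Fin (n + 1), a < b → (p a).1 = (p b).1 → termRank d (p a) < termRank d (p b) := by
    intro a b hab h1
    have hne : p a ≠ p b := fun h => (ne_of_lt hab) (hinj h)
    have h2 : (p a).2 ≠ (p b).2 := fun h => hne (Prod.ext h1 h)
    obtain ⟨i, hi⟩ := Function.ne_iff.mp h2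
    have hpa : p a = ((p a).1, (p a).2) := rfl
    have hpb : p b = ((p a).1, (p b).2) := by rw [h1]
    have hda : IsDominant d v ε (θ a) ((p a).1, (p a).2) := hpa ▸ hdom a
    have hdb : IsDominant d v ε (θ b) ((p a).1, (p b).2) := hpb ▸ hdom b
    have hmono : ∀ j, dRank d ((p a).2 j) ≤ dRank d ((p b).2 j) := by
      intro j
      by_cases hj : (p a).2 j = (p b).2 j
      · rw [hj]
      · exact (dRank_lt_of_lt d (d_lt_of_dominant d v ε (hθ hab) _ _ _ hda hdb j hj)).le
    have hstrict : dRank d ((p a).2 i) < dRank d ((p b).2 i) :=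
      dRank_lt_of_lt d (d_lt_of_dominant d v ε (hθ hab) _ _ _ hda hdb i hi)
    unfold termRank
    exact sum_lt_sum (fun j _ => hmono j) ⟨i, mem_univ _, hstrict⟩
  have hsame : ∀ a b : Fin (n + 1), (p a).1 = (p b).1 → termRank d (p a) = termRank d (p b) → a = b := by
    intro a b h1 h2
    rcases lt_trichotomy a b with h | h | h
    · exact absurd h2 (ne_of_lt (hkey a b h h1))
    · exact h
    · exact absurd h2.symm (ne_of_lt (hkey b a h h1.symm))
  -- (2) slopes strictly increase
  have hslope : ∀ a b : Fin (n + 1), TropicalCensus.slope d (p a) = TropicalCensus.slope d (p b) → a = b := by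
    intro a b hs
    rcases lt_trichotomy a b with h | h | h
    · exact absurd hs (ne_of_lt (slope_lt_of_dominant d v ε (hθ h) (fun e => (ne_of_lt h) (hinj e)) (hdom a) (hdom b)))
    · exact h
    · exact absurd hs.symm (ne_of_lt (slope_lt_of_dominant d v ε (hθ h) (fun e => (ne_of_lt h) (hinj e)) (hdom b) (hdom a)))
  -- (3) transposition terms have equal classes (symmetry)
  have hdiag : ∀ k, (p k).1 = Equiv.swap 0 1 → (p k).2 0 = (p k).2 1 := by
    intro k hk
    have h := (isDominant_symm_involutive d v ε hv hεs (θ k) (p k).1 (p k).2 (hdom k)).2 0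
    rw [hk, Equiv.swap_apply_left] at h
    exact h.symm
  -- (4) the numbering: identity terms by total rank `0 … 2K−2`; transposition terms of class rank `r`: `0 ↦ 0`, `K−1 ↦ 2K−2`,
  --     `1 ≤ r ≤ K−2 ↦ 2K−2+r`.
  have hrank : ∀ k, termRank d (p k) ≤ 2 * K - 2 := by
    intro k; have := termRank_le d (p k); omega
  have hdr : ∀ k, dRank d ((p k).2 0) ≤ K - 1 := fun k => dRank_le d _
  classical
  let code : Fin (n + 1) → ℕ := fun k =>
    if (p k).1 = 1 then termRank d (p k)
    else if dRank d ((p k).2 0) = 0 then 0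
    else if dRank d ((p k).2 0) = K - 1 then 2 * K - 2
    else 2 * K - 2 + dRank d ((p k).2 0)
  have hcode_lt : ∀ k, code k < 3 * K - 3 := by
    intro k
    have h1 := hrank k; have h2 := hdr k
    simp only [code]
    split_ifs <;> omega
  -- slope of a transposition chain term with class rank equal to that of `l`: `2 d l`
  have hswap_slope : ∀ k, (p k).1 = Equiv.swap 0 1 →
      TropicalCensus.slope d (p k) = 2 * (d ((p k).2 0) : ℤ) := by
    intro k hk
    rw [slope_two, ← hdiag k hk]; ring
  have hid_slope : ∀ k, TropicalCensus.slope d (p k) = (d ((p k).2 0) : ℤ) + d ((p k).2 1) := fun k => slope_two d (p k)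
  have hf : Function.Injective (fun k => (⟨code k, hcode_lt k⟩ : Fin (3 * K - 3))) := by
    intro a b hab
    have h : code a = code b := by
      have := congrArg Fin.val hab
      simpa using this
    simp only [code] at h
    have hra := hrank a; have hrb := hrank b; have hda := hdr a; have hdb := hdr b
    rcases perm_fin_two (p a).1 with ha1 | ha1 <;> rcases perm_fin_two (p b).1 with hb1 | hb1
    · -- id / id
      rw [if_pos ha1, if_pos hb1] at h
      exact hsame a b (by rw [ha1, hb1]) h
    · -- id / swap : only the two extreme slots can collide, and then the slopes agree
      have hb1' : ¬ (p b).1 = 1 := by rw [hb1]; decide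
      rw [if_pos ha1, if_neg hb1'] at h
      apply hslope
      rw [hid_slope a, hswap_slope b hb1]
      rw [termRank_two] at h
      have h0 := dRank_le d ((p a).2 0); have h1 := dRank_le d ((p a).2 1)
      split_ifs at h with hr0 hrK
      · -- total rank 0: both columns of `a` have rank 0 = rank of `b`'s class
        have e0 : dRank d ((p a).2 0) = dRank d ((p b).2 0) := by omega
        have e1 : dRank d ((p a).2 1) = dRank d ((p b).2 0) := by omega
        rw [d_eq_of_dRank_eq d e0, d_eq_of_dRank_eq d e1]; ring
      · have e0 : dRank d ((p a).2 0) = dRank d ((p b).2 0) := by omega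
        have e1 : dRank d ((p a).2 1) = dRank d ((p b).2 0) := by omega
        rw [d_eq_of_dRank_eq d e0, d_eq_of_dRank_eq d e1]; ring
      · exfalso; omega
    · -- swap / id (symmetric)
      have ha1' : ¬ (p a).1 = 1 := by rw [ha1]; decide
      rw [if_neg ha1', if_pos hb1] at h
      apply hslope
      rw [hid_slope b, hswap_slope a ha1]
      rw [termRank_two] at h
      have h0 := dRank_le d ((p b).2 0); have h1 := dRank_le d ((p b).2 1)
      split_ifs at h with hr0 hrK
      · have e0 : dRank d ((p b).2 0) = dRank d ((p a).2 0) := by omega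
        have e1 : dRank d ((p b).2 1) = dRank d ((p a).2 0) := by omega
        rw [d_eq_of_dRank_eq d e0, d_eq_of_dRank_eq d e1]; ring
      · have e0 : dRank d ((p b).2 0) = dRank d ((p a).2 0) := by omega
        have e1 : dRank d ((p b).2 1) = dRank d ((p a).2 0) := by omega
        rw [d_eq_of_dRank_eq d e0, d_eq_of_dRank_eq d e1]; ring
      · exfalso; omega
    · -- swap / swap: equal codes ⇒ equal class ranks ⇒ equal slopes
      have ha1' : ¬ (p a).1 = 1 := by rw [ha1]; decide
      have hb1' : ¬ (p b).1 = 1 := by rw [hb1]; decide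
      rw [if_neg ha1', if_neg hb1'] at h
      apply hslope
      rw [hswap_slope a ha1, hswap_slope b hb1]
      have e0 : dRank d ((p a).2 0) = dRank d ((p b).2 0) := by
        split_ifs at h <;> omega
      rw [d_eq_of_dRank_eq d e0]
  have hcard := Fintype.card_le_of_injective _ hf
  simp only [Fintype.card_fin] at hcard
  omega

end Summit.ValiantsHypothesis.ValiantsHypothesis.Theorems.KPlusLogSqLaw
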